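/-
Copyright (c) 2026 the pub-hodgecm-mathlib formalisation cell (harness21).  Prover seat hodgecm-mathlib-K2Liu-p14 (g4) (writer of record of the (K1b-♮)
package ★ p863141, K1b∕ρ desk; LEAD F0P6-plan (g14) BATCH #139 (1)), Track B «K2-LIT» ∕ hLiu418 #184♮, socket #41 KIND 1:
(K1b-OF-RECORD) THE K1-b♮ BLOCK OF RECORD AT `n = 2`: THE PINNED LINE TERM (★ `K2LiuKindOnePin`) RUN THROUGH THE ENGINE.  THEOREMS ONLY.
-/
import Summits.HodgeConjecture.HodgeConjecture.Theorems.K2LiuKindOneLineTermEngine        -- ★ (this seat) (K1b-ENGINE) `exists_kindOne_lineTerm_of_pinnedTerm`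
import Summits.HodgeConjecture.HodgeConjecture.Theorems.K2LiuKindOneLinePin               -- ★ p863230 ∕ p863263 (LH4-p14 (g8)) (P-pin) `exists_pinConst_line(_inl)`
import Summits.HodgeConjecture.HodgeConjecture.Theorems.K2LiuConstantTermRestTranslate    -- ★ (ρ8) F0P2-p10 (g3) `tsum_rest_unipDeltaRat_mul_family`
import Summits.HodgeConjecture.HodgeConjecture.Theorems.K2LiuRankOneRowSection            -- ★ p863259 (ρ6a)(i) C10-p03 `exists_normalised_rowSection`
import Summits.HodgeConjecture.HodgeConjecture.Theorems.K2LiuRankOneTwoByTwo              -- ★ `exists_vecMulVec_of_det_eq_zero`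
import Summits.HodgeConjecture.HodgeConjecture.Theorems.K2LiuRankOneLeviConjIndex         -- ★ `exists_levi_conj_index`
import Summits.HodgeConjecture.HodgeConjecture.Theorems.K2LiuSiegelDoubledLeviMatrix      -- ★ `exists_leviHom`
import Summits.HodgeConjecture.HodgeConjecture.Theorems.K2LiuLineCornerChart              -- ★ p862662 `exists_lineChart`
import Literature.NumberTheory.Automorphic.AdicCompletionCompact                            -- ★ `locallyCompactSpace_adeleRing'`
import Literature.NumberTheory.Automorphic.AdelicSecondCountable                            -- ★ `secondCountableTopology_adeleRing`
import HarnessLib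

/-!
# Crux `HLiu418`, socket #41, KIND 1 — (K1b-OF-RECORD) `K2LiuKindOneLineTermOfRecord`: THE K1-b♮ BLOCK OF RECORD AT `n = 2`

Cell `hodgecm-mathlib`, crux item hLiu418 = `stmt-HodgeConjecture-24832` (helper lane `--supports … --as helper`, count-neutral), route of record
`HCCMUnconditional`; squad K2 ∕ K2Liu, road `K2_Liu`, socket #41 `sig_K2LiuSiegelEisensteinContinuation`, KIND 1, block K1-b♮ (★ ED. 20 :109–:126).

THE MATHEMATICS [KudlaRallis1994, §2 (2.10)–(2.12)], [MoeglinWaldspurger1995, I.2.6, II.1.7, IV.1.9], [Shimura1997, §18.4 Prop. 18.14], [Tan1999, §4 Prop. 4.8].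
The PINNED TERM of the engine ★ `exists_kindOne_lineTerm_of_pinnedTerm` is instantiated with THE LINE TERM OF RECORD: for a rank-one `T_L`-skew `S` choose a
tensor presentation `S = u ⊗ w` (★ `exists_vecMulVec_of_det_eq_zero`), the line representative `ĝ = γ[w]` (★ p863259 `exists_normalised_rowSection`) and the
transported index `S'` (★ `exists_levi_conj_index`), and put `T S s h := (∫β)⁻¹ • (C • W_{S'}(ν)(y ↦ f_s(blkD(·, y) · Λĝ · h))(1))` — the rank-one Whittaker
coefficient of the corner translate along the doubled line, ★ `K2LiuKindOnePin.exists_pinConst_line` (corner enumeration `e (1,0) = 1`, line `B`) ∕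
`exists_pinConst_line_inl` (`e (1,0) = 0`, line `A`), which supply (hol) and (pin).  The frame — see-saw datum `dA := dV ∘ castAdd`, `dB := dV ∘ natAdd`,
`eA = eB` the unique equivalence `Fin 1 × Fin 1 ≃ Fin 1`, the Levi chart `Λ` (★ `exists_leviHom`), the additive Haar measure `μ := addHaar` of `𝔸_{L⁺}` over
`borel`, the line charts (★ p862662 `exists_lineChart`) — is CHOSEN here; the (P-dec) decay letters are therefore taken FOR EVERY FRAME (the payer's theorem
has the frame by value), in `W`-currency and `D`-polynomial (desk word #6 (d)); the `REST`-cell invariance is ★ (ρ8) `tsum_rest_unipDeltaRat_mul_family`, the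
level ★ (ρ7) (inside the engine), so that BY VALUE remain exactly: the lattice letters `hlatU` ((P-supp-lat)), `Nb`, and the two decay letters `hWdec1` ∕ `hWdec0`.
* **`exists_kindOne_lineTerm_of_record`** — socket prefix at `n = 2` VERBATIM ⊢ the twelve K1-b♮ letters of ★ ED. 20 :109–:126 (read at `n = 2`).
HONEST LABEL.  Count-neutral helper, hypothesis-first in `hlatU Nb hWdec1 hWdec0`; it closes no socket by itself: `HC_CM` is proved only modulo the 7 printed
citations (2 remaining named inputs: hLiu418 = `stmt-HodgeConjecture-24832`, h413 = `stmt-HodgeConjecture-24833`) until rung 0 closes.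

## References
* [KudlaRallis1994] S. Kudla, S. Rallis, Ann. of Math. 140 (1994): §2 (2.10)–(2.12).
* [MoeglinWaldspurger1995] C. Mœglin, J.-L. Waldspurger, *Spectral decomposition and Eisenstein series* (1995): I.2.6, II.1.7, IV.1.9.
* [Shimura1997] G. Shimura, CBMS 93 (1997): §18.4 Prop. 18.14.   * [Tan1999] V. Tan, Canad. J. Math. 51 (1999): §4 Prop. 4.8.
-/

set_option autoImplicit false
-- the mandated namespace repeats the single-problem summit's segment (`HodgeConjecture.HodgeConjecture`)
set_option linter.dupNamespace false

noncomputable section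

open scoped Matrix ENNReal NNReal Topology ComplexConjugate
open NumberField IsDedekindDomain MeasureTheory MeasureTheory.Measure Filter Set Function Metric
open Literature.NumberTheory.Automorphic Literature.NumberTheory.Automorphic.UnitaryGroup Literature.NumberTheory.GaloisRepresentations
open Literature.NumberTheory.GelbartRogawski1991 Literature.NumberTheory.GelbartRogawski1991.GRConstruction
open Literature.NumberTheory.GelbartRogawski1991.AdaptedBlocks
open Literature.NumberTheory.K2Lit.SiegelDoubled Literature.MeasureTheory.Group
open Literature.NumberTheory.Automorphic.IdeleClassGroup
open UnitaryDualPair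

namespace Summit.HodgeConjecture.HodgeConjecture.Cruxes.HLiu418.K2LiuKindOneLineTermOfRecord

open K2LiuSiegelUnipotentFourierDefs K2LiuSiegelUnipotentCharacters K2LiuUnipotentCoveringWeight K2LiuSiegelFourierCoeffDelta
open K2LiuSiegelRationalLeviDecomposition K2LiuSiegelMiddleCellSortedPattern K2LiuSiegelMiddleCellLeviCriterion K2LiuSiegelBruhatMiddleCellDelta
open K2LiuKindOneLineTermEngine (exists_kindOne_lineTerm_of_pinnedTerm)
open K2LiuKindOneLinePin (exists_pinConst_line exists_pinConst_line_inl)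
open K2LiuConstantTermRestTranslate (tsum_rest_unipDeltaRat_mul_family)
open K2LiuRankOneRowSection (exists_normalised_rowSection)
open K2LiuRankOneTwoByTwo (exists_vecMulVec_of_det_eq_zero)
open K2LiuRankOneLeviConjIndex (exists_levi_conj_index)
open K2LiuSiegelDoubledLeviMatrix (exists_leviHom)
open K2LiuLineCornerChart (exists_lineChart)

set_option maxHeartbeats 1600000 in
open Classical in
/-- **(K1b-OF-RECORD) THE K1-b♮ BLOCK OF RECORD AT `n = 2`.**  Socket prefix at `n = 2` VERBATIM; BY VALUE: the lattice letters `hlatU` (for every open level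
`U ≤ H(𝔸_f)`; payer (P-supp-lat)), `Nb`, and the two (P-dec) decay letters FOR EVERY FRAME, `W`-currency, `D`-polynomial: `hWdec1` (corner enumeration
`e (1,0) = 1`, line `B`, `blkD(1,y)`, `toBlocks₂₂`) and `hWdec0` (`e (1,0) = 0`, line `A`, `blkD(y,1)`, `toBlocks₁₁`).  THEN the twelve K1-b♮ letters of ★ ED. 20
:109–:126 (at `n = 2`) — via ★ `exists_kindOne_lineTerm_of_pinnedTerm` at the pinned term of ★ `K2LiuKindOnePin` with the frame chosen here and
`hrestL :=` ★ `tsum_rest_unipDeltaRat_mul_family`.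
[cite: KudlaRallis1994, §2 (2.10)–(2.12)] [cite: MoeglinWaldspurger1995, I.2.6, II.1.7, IV.1.9] [cite: Shimura1997, §18.4 Prop. 18.14] [cite: Tan1999, §4 Prop. 4.8] -/
theorem exists_kindOne_lineTerm_of_record
    (L : Type) [Field L] [NumberField L] [IsCMField L] (e : Fin 2 × Fin 1 ≃ Fin 2)
    (dV : Fin 2 → L) (hdV : ∀ i, IsCMField.complexConj L (dV i) = dV i) (hdV0 : ∀ i, dV i ≠ 0)
    (dW : Fin 1 → L) (hdW : ∀ i, IsCMField.complexConj L (dW i) = dW i) (hdW0 : ∀ i, dW i ≠ 0)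
    (lam : IdeleClassGroup L →ₜ* Circle) (hlam : IsConjugateSymplectic L lam) (hw : HasWeight L lam 1)
    (𝒦 : IwasawaDatum L e dV hdV dW hdW) (h𝒦 : 𝒦.IsStd) (f : ℂ → HA L e dV hdV dW hdW → ℂ)
    (hstd : IsStandardSectionFamily 𝒦 (toHeckeCharacter L lam⁻¹) f) (hcont : ∀ s, Continuous (f s))
    [MeasurableSpace (unipDelta L e dV hdV dW hdW)] [BorelSpace (unipDelta L e dV hdV dW hdW)]
    (νN : Measure (unipDelta L e dV hdV dW hdW)) [νN.IsHaarMeasure]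
    (β : unipDelta L e dV hdV dW hdW → ℝ≥0∞) (hβ : IsCoveringWeight (unipDeltaRat L e dV hdV dW hdW) β)
    (hβ0 : ∫⁻ u, β u ∂νN ≠ 0) (hβtop : ∫⁻ u, β u ∂νN ≠ ∞)
    {K : Set (unipDelta L e dV hdV dW hdW)} (hK : IsCompact K) (hβK : ∀ u, β u ≤ K.indicator 1 u)
    (wq : unipDeltaRat L e dV hdV dW hdW → ratH L e dV hdV dW hdW)
    (hwq : ∀ ν, ((wq ν : ratH L e dV hdV dW hdW) : HA L e dV hdV dW hdW) = weylDelta L e dV hdV dW hdW * ((ν : unipDelta L e dV hdV dW hdW) : HA L e dV hdV dW hdW))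
    -- (P-supp-lat) the lattice letters, for EVERY open level `U ≤ H(𝔸_f)` (by value)
    (hlatU : ∀ U : Subgroup (UnitaryGroup.finAdelic (Fp L) L (IsCMField.complexConj L) (2 + 2) (hermD L e dV hdV dW hdW)),
      IsOpen (U : Set (UnitaryGroup.finAdelic (Fp L) L (IsCMField.complexConj L) (2 + 2) (hermD L e dV hdV dW hdW))) →
      ∃ (Tδ : Finset (HeightOneSpectrum (𝓞 L))) (δ : HeightOneSpectrum (𝓞 L) → ℕ) (k : ℕ), (∀ w ∉ Tδ, δ w = 0) ∧
        ∀ (S : skewMatrices ((IsCMField.complexConj L : L ≃ₐ[Fp L] L) : L →+* L) ((gramR L e dV hdV dW hdW).map (algebraMap (Fp L) L)))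
          (h : HA L e dV hdV dW hdW),
          (∀ b : unipDelta L e dV hdV dW hdW,
            UnitaryGroup.archPart (Fp L) L (IsCMField.complexConj L) (2 + 2) (hermD L e dV hdV dW hdW) (b : HA L e dV hdV dW hdW) = 1 →
            UnitaryGroup.finPart (Fp L) L (IsCMField.complexConj L) (2 + 2) (hermD L e dV hdV dW hdW) (h⁻¹ * (b : HA L e dV hdV dW hdW) * h) ∈ U →
            unipDeltaChar L e dV hdV dW hdW (S : Matrix (Fin 2) (Fin 2) L) (b : HA L e dV hdV dW hdW) = 1) →
          ∀ w : HeightOneSpectrum (𝓞 L), ∃ m : ℕ,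
            ((Ideal.absNorm w.asIdeal : ℕ) : ℝ) ^ m ≤
                ((Ideal.absNorm w.asIdeal : ℕ) : ℝ) ^ δ w * (GLn.localHeight (2 + 2) L w (h : GL (Fin (2 + 2)) (AdeleRing (𝓞 L) L)) : ℝ) ^ k ∧
              ∀ a b, Valued.v ((((S : Matrix (Fin 2) (Fin 2) L) a b : L)) : w.adicCompletion L) ≤ WithZero.exp (m : ℤ))
    -- (P-dec) the decay exponent `Nb` and the two `D`-polynomial decay letters in `W`-currency, FOR EVERY FRAME (by value)
    (Nb : ℕ)
    (hWdec1 : e (1, 0) = 1 → ∀ {n₁ n₂ : ℕ} (eA : Fin 1 × Fin 1 ≃ Fin n₁) (eB : Fin 1 × Fin 1 ≃ Fin n₂)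
      (dA : Fin 1 → L) (hdA : ∀ i, IsCMField.complexConj L (dA i) = dA i)
      (dB : Fin 1 → L) (hdB : ∀ i, IsCMField.complexConj L (dB i) = dB i)
      (hVA : ∀ i, dV (Fin.castAdd 1 i) = dA i) (hVB : ∀ j, dV (Fin.natAdd 1 j) = dB j)
      [MeasurableSpace (unipDelta L eB dB hdB dW hdW)] [BorelSpace (unipDelta L eB dB hdB dW hdW)]
      (Λ : GL (Fin 2) (AdeleRing (𝓞 L) L) →* HA L e dV hdV dW hdW)
      (hΛ : ∀ g : GL (Fin 2) (AdeleRing (𝓞 L) L), blk L e dV hdV dW hdW (Λ g) =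
        cayR (AdeleRing (𝓞 L) L) (Fin 2) * Matrix.fromBlocks (g : Matrix (Fin 2) (Fin 2) (AdeleRing (𝓞 L) L)) 0 0
          (((gramR L e dV hdV dW hdW).map ((algebraMap L (AdeleRing (𝓞 L) L)).comp (algebraMap (Fp L) L)))⁻¹ *
            (((g⁻¹ : GL (Fin 2) (AdeleRing (𝓞 L) L)) : Matrix (Fin 2) (Fin 2) (AdeleRing (𝓞 L) L)).map
              (conjAdele (Fp L) L (IsCMField.complexConj L)))ᵀ *
            (gramR L e dV hdV dW hdW).map ((algebraMap L (AdeleRing (𝓞 L) L)).comp (algebraMap (Fp L) L))) *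
          cayRinv (AdeleRing (𝓞 L) L) (Fin 2))
      [MeasurableSpace (AdeleRing (𝓞 (Fp L)) (Fp L))] [BorelSpace (AdeleRing (𝓞 (Fp L)) (Fp L))]
      (μ : Measure (AdeleRing (𝓞 (Fp L)) (Fp L))) [μ.IsAddHaarMeasure]
      (nB : AdeleRing (𝓞 (Fp L)) (Fp L) → unipDelta L eB dB hdB dW hdW) (_ : Continuous nB) (_ : ∀ s t, nB (s + t) = nB s * nB t)
      (_ : ∀ t, (blk L eB dB hdB dW hdW (nB t : HA L eB dB hdB dW hdW)).toBlocks₁₂ =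
        Matrix.of fun _ _ => AdeleRing.baseChange (Fp L) L t * algebraMap L (AdeleRing (𝓞 L) L) (imagUnit L))
      (γ : Projectivization L (Fin 2 → L) → GL (Fin 2) L)
      (_ : ∀ p, Projectivization.mk L ((γ p : Matrix (Fin 2) (Fin 2) L) 1) (row_ne_zero (γ p) 1) = p),
      ∀ z : ℂ, 0 < z.re → ∃ C a a₂ c a' r : ℝ, 0 ≤ C ∧ 0 ≤ a ∧ 0 ≤ a₂ ∧ 0 < c ∧ 0 ≤ a' ∧ 0 < r ∧
        ∀ (S : skewMatrices ((IsCMField.complexConj L : L ≃ₐ[Fp L] L) : L →+* L) ((gramR L e dV hdV dW hdW).map (algebraMap (Fp L) L))) (u w : Fin 2 → L),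
          (S : Matrix (Fin 2) (Fin 2) L) = Matrix.vecMulVec u w → u ≠ 0 → ∀ (hw : w ≠ 0) (S' : Matrix (Fin 2) (Fin 2) L),
          (∀ v : HA L e dV hdV dW hdW, v ∈ unipDelta L e dV hdV dW hdW →
            unipDeltaChar L e dV hdV dW hdW (S : Matrix (Fin 2) (Fin 2) L) ((Λ (Matrix.GeneralLinearGroup.map (algebraMap L (AdeleRing (𝓞 L) L)) (γ (Projectivization.mk L w hw))))⁻¹ * v * Λ (Matrix.GeneralLinearGroup.map (algebraMap L (AdeleRing (𝓞 L) L)) (γ (Projectivization.mk L w hw)))) =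
              unipDeltaChar L e dV hdV dW hdW S' v) →
          ∀ D : ℕ, 1 ≤ D → (∀ i j, IsIntegral ℤ ((D : L) * (S : Matrix (Fin 2) (Fin 2) L) i j)) →
          ∀ s : ℂ, dist s z < r → ∀ h : HA L e dV hdV dW hdW,
            ‖whittakerDelta L eB dB hdB dW hdW (Measure.map nB μ)
                ((Matrix.reindex (idxSplit e eA eB) (idxSplit e eA eB) S').toBlocks₂₂)
                (fun y => f s (blkD L e eA eB dA hdA dB hdB dV hdV hVA hVB dW hdW (1, y) * (Λ (Matrix.GeneralLinearGroup.map (algebraMap L (AdeleRing (𝓞 L) L)) (γ (Projectivization.mk L w hw))) * h))) 1‖ ≤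
              C * adelicHeightGL (2 + 2) L (h : GL (Fin (2 + 2)) (AdeleRing (𝓞 L) L)) ^ a * (D : ℝ) ^ a₂ *
                (Real.exp (-(c * adelicHeightGL (2 + 2) L (h : GL (Fin (2 + 2)) (AdeleRing (𝓞 L) L)) ^ (-a') * ‖(fun i j => NumberField.mixedEmbedding L ((S : Matrix (Fin 2) (Fin 2) L) i j))‖)) * (1 + ‖(fun i j => NumberField.mixedEmbedding L ((S : Matrix (Fin 2) (Fin 2) L) i j))‖) ^ Nb))
    (hWdec0 : e (1, 0) = 0 → ∀ {n₁ n₂ : ℕ} (eA : Fin 1 × Fin 1 ≃ Fin n₁) (eB : Fin 1 × Fin 1 ≃ Fin n₂)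
      (dA : Fin 1 → L) (hdA : ∀ i, IsCMField.complexConj L (dA i) = dA i)
      (dB : Fin 1 → L) (hdB : ∀ i, IsCMField.complexConj L (dB i) = dB i)
      (hVA : ∀ i, dV (Fin.castAdd 1 i) = dA i) (hVB : ∀ j, dV (Fin.natAdd 1 j) = dB j)
      [MeasurableSpace (unipDelta L eA dA hdA dW hdW)] [BorelSpace (unipDelta L eA dA hdA dW hdW)]
      (Λ : GL (Fin 2) (AdeleRing (𝓞 L) L) →* HA L e dV hdV dW hdW)
      (hΛ : ∀ g : GL (Fin 2) (AdeleRing (𝓞 L) L), blk L e dV hdV dW hdW (Λ g) =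
        cayR (AdeleRing (𝓞 L) L) (Fin 2) * Matrix.fromBlocks (g : Matrix (Fin 2) (Fin 2) (AdeleRing (𝓞 L) L)) 0 0
          (((gramR L e dV hdV dW hdW).map ((algebraMap L (AdeleRing (𝓞 L) L)).comp (algebraMap (Fp L) L)))⁻¹ *
            (((g⁻¹ : GL (Fin 2) (AdeleRing (𝓞 L) L)) : Matrix (Fin 2) (Fin 2) (AdeleRing (𝓞 L) L)).map
              (conjAdele (Fp L) L (IsCMField.complexConj L)))ᵀ *
            (gramR L e dV hdV dW hdW).map ((algebraMap L (AdeleRing (𝓞 L) L)).comp (algebraMap (Fp L) L))) *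
          cayRinv (AdeleRing (𝓞 L) L) (Fin 2))
      [MeasurableSpace (AdeleRing (𝓞 (Fp L)) (Fp L))] [BorelSpace (AdeleRing (𝓞 (Fp L)) (Fp L))]
      (μ : Measure (AdeleRing (𝓞 (Fp L)) (Fp L))) [μ.IsAddHaarMeasure]
      (nA : AdeleRing (𝓞 (Fp L)) (Fp L) → unipDelta L eA dA hdA dW hdW) (_ : Continuous nA) (_ : ∀ s t, nA (s + t) = nA s * nA t)
      (_ : ∀ t, (blk L eA dA hdA dW hdW (nA t : HA L eA dA hdA dW hdW)).toBlocks₁₂ =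
        Matrix.of fun _ _ => AdeleRing.baseChange (Fp L) L t * algebraMap L (AdeleRing (𝓞 L) L) (imagUnit L))
      (γ : Projectivization L (Fin 2 → L) → GL (Fin 2) L)
      (_ : ∀ p, Projectivization.mk L ((γ p : Matrix (Fin 2) (Fin 2) L) 1) (row_ne_zero (γ p) 1) = p),
      ∀ z : ℂ, 0 < z.re → ∃ C a a₂ c a' r : ℝ, 0 ≤ C ∧ 0 ≤ a ∧ 0 ≤ a₂ ∧ 0 < c ∧ 0 ≤ a' ∧ 0 < r ∧
        ∀ (S : skewMatrices ((IsCMField.complexConj L : L ≃ₐ[Fp L] L) : L →+* L) ((gramR L e dV hdV dW hdW).map (algebraMap (Fp L) L))) (u w : Fin 2 → L),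
          (S : Matrix (Fin 2) (Fin 2) L) = Matrix.vecMulVec u w → u ≠ 0 → ∀ (hw : w ≠ 0) (S' : Matrix (Fin 2) (Fin 2) L),
          (∀ v : HA L e dV hdV dW hdW, v ∈ unipDelta L e dV hdV dW hdW →
            unipDeltaChar L e dV hdV dW hdW (S : Matrix (Fin 2) (Fin 2) L) ((Λ (Matrix.GeneralLinearGroup.map (algebraMap L (AdeleRing (𝓞 L) L)) (γ (Projectivization.mk L w hw))))⁻¹ * v * Λ (Matrix.GeneralLinearGroup.map (algebraMap L (AdeleRing (𝓞 L) L)) (γ (Projectivization.mk L w hw)))) =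
              unipDeltaChar L e dV hdV dW hdW S' v) →
          ∀ D : ℕ, 1 ≤ D → (∀ i j, IsIntegral ℤ ((D : L) * (S : Matrix (Fin 2) (Fin 2) L) i j)) →
          ∀ s : ℂ, dist s z < r → ∀ h : HA L e dV hdV dW hdW,
            ‖whittakerDelta L eA dA hdA dW hdW (Measure.map nA μ)
                ((Matrix.reindex (idxSplit e eA eB) (idxSplit e eA eB) S').toBlocks₁₁)
                (fun y => f s (blkD L e eA eB dA hdA dB hdB dV hdV hVA hVB dW hdW (y, 1) * (Λ (Matrix.GeneralLinearGroup.map (algebraMap L (AdeleRing (𝓞 L) L)) (γ (Projectivization.mk L w hw))) * h))) 1‖ ≤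
              C * adelicHeightGL (2 + 2) L (h : GL (Fin (2 + 2)) (AdeleRing (𝓞 L) L)) ^ a * (D : ℝ) ^ a₂ *
                (Real.exp (-(c * adelicHeightGL (2 + 2) L (h : GL (Fin (2 + 2)) (AdeleRing (𝓞 L) L)) ^ (-a') * ‖(fun i j => NumberField.mixedEmbedding L ((S : Matrix (Fin 2) (Fin 2) L) i j))‖)) * (1 + ‖(fun i j => NumberField.mixedEmbedding L ((S : Matrix (Fin 2) (Fin 2) L) i j))‖) ^ Nb)) :
    ∃ (Ebc : skewMatrices ((IsCMField.complexConj L : L ≃ₐ[Fp L] L) : L →+* L) ((gramR L e dV hdV dW hdW).map (algebraMap (Fp L) L)) → ℂ → HA L e dV hdV dW hdW → ℂ),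
      (∀ S x, DifferentiableOn ℂ (fun s => Ebc S s x) {s : ℂ | 0 < s.re}) ∧
      (∀ S : skewMatrices ((IsCMField.complexConj L : L ≃ₐ[Fp L] L) : L →+* L) ((gramR L e dV hdV dW hdW).map (algebraMap (Fp L) L)),
        (S : Matrix (Fin 2) (Fin 2) L) ≠ 0 → (S : Matrix (Fin 2) (Fin 2) L).det = 0 → ∀ (s : ℂ) (h : HA L e dV hdV dW hdW), ((2 : ℕ) : ℝ) / 2 < s.re →
          ((∫⁻ u, β u ∂νN).toReal⁻¹ : ℝ) •
            (∫ u, (β u).toReal • (conj (unipDeltaChar L e dV hdV dW hdW (S : Matrix (Fin 2) (Fin 2) L) (u : HA L e dV hdV dW hdW) : ℂ) *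
              (∑' q : ↥(({Quotient.mk (MulAction.orbitRel (siegelDeltaRat L e dV hdV dW hdW) (ratH L e dV hdV dW hdW)) 1} ∪
              Set.range (fun ν : unipDeltaRat L e dV hdV dW hdW =>
                (Quotient.mk (MulAction.orbitRel (siegelDeltaRat L e dV hdV dW hdW) (ratH L e dV hdV dW hdW)) (wq ν) :
                  SiegelDeltaQuot L e dV hdV dW hdW)))ᶜ : Set (SiegelDeltaQuot L e dV hdV dW hdW)),
                f s ((((Quotient.out (q : SiegelDeltaQuot L e dV hdV dW hdW) : ratH L e dV hdV dW hdW) : HA L e dV hdV dW hdW)) *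
                  ((u : HA L e dV hdV dW hdW) * h)))) ∂νN) = Ebc S s h) ∧
      ∃ (τb : skewMatrices ((IsCMField.complexConj L : L ≃ₐ[Fp L] L) : L →+* L) ((gramR L e dV hdV dW hdW).map (algebraMap (Fp L) L)) → ℝ),
        (∀ S : skewMatrices ((IsCMField.complexConj L : L ≃ₐ[Fp L] L) : L →+* L) ((gramR L e dV hdV dW hdW).map (algebraMap (Fp L) L)),
          ‖(fun i j => NumberField.mixedEmbedding L ((S : Matrix (Fin 2) (Fin 2) L) i j))‖ ≤ τb S) ∧
        ∃ Nb : ℕ,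
          (∀ z : ℂ, 0 < z.re → ∃ C a c a' r : ℝ, 0 ≤ C ∧ 0 ≤ a ∧ 0 < c ∧ 0 ≤ a' ∧ 0 < r ∧ ∀ S (s : ℂ), dist s z < r → ∀ h : HA L e dV hdV dW hdW,
            ‖Ebc S s h‖ ≤ C * adelicHeightGL (2 + 2) L (h : GL (Fin (2 + 2)) (AdeleRing (𝓞 L) L)) ^ a *
              (Real.exp (-(c * adelicHeightGL (2 + 2) L (h : GL (Fin (2 + 2)) (AdeleRing (𝓞 L) L)) ^ (-a') * τb S)) * (1 + τb S) ^ Nb)) ∧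
          ∃ Cb κb : ℝ, 0 < Cb ∧ 0 ≤ κb ∧
            (∀ S (s : ℂ) (h : HA L e dV hdV dW hdW), 0 < s.re → Ebc S s h ≠ 0 →
              ∃ D : ℕ, 1 ≤ D ∧ (D : ℝ) ≤ Cb * adelicHeightGL (2 + 2) L (h : GL (Fin (2 + 2)) (AdeleRing (𝓞 L) L)) ^ κb ∧
                ∀ i j, IsIntegral ℤ ((D : L) * (S : Matrix (Fin 2) (Fin 2) L) i j)) := by
  -- THE ROW SECTION, THE LEVI CHART AND THE RANK-ONE DECORATIONS (chosen once; kept before any local instance)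
  obtain ⟨γ, hγ0⟩ := @exists_normalised_rowSection L _
  have hγ : ∀ p, Projectivization.mk L ((γ p : Matrix (Fin 2) (Fin 2) L) 1) (row_ne_zero (γ p) 1) = p := hγ0.1
  clear hγ0
  obtain ⟨Λ, -, hΛ⟩ := exists_leviHom L e dV hdV dW hdW hdV0 hdW0
  have hdeco : ∀ S : skewMatrices ((IsCMField.complexConj L : L ≃ₐ[Fp L] L) : L →+* L) ((gramR L e dV hdV dW hdW).map (algebraMap (Fp L) L)),
      (S : Matrix (Fin 2) (Fin 2) L) ≠ 0 → (S : Matrix (Fin 2) (Fin 2) L).det = 0 →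
      ∃ u w : Fin 2 → L, u ≠ 0 ∧ w ≠ 0 ∧ (S : Matrix (Fin 2) (Fin 2) L) = Matrix.vecMulVec u w := by
    intro S h0 hd
    exact exists_vecMulVec_of_det_eq_zero (K := L) h0 hd
  choose! fu fw hfu hfw hfS using hdeco
  have hidx : ∀ (S : skewMatrices ((IsCMField.complexConj L : L ≃ₐ[Fp L] L) : L →+* L) ((gramR L e dV hdV dW hdW).map (algebraMap (Fp L) L)))
      (h0 : (S : Matrix (Fin 2) (Fin 2) L) ≠ 0) (hd : (S : Matrix (Fin 2) (Fin 2) L).det = 0), ∃ S' : Matrix (Fin 2) (Fin 2) L,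
      ∀ v : HA L e dV hdV dW hdW, v ∈ unipDelta L e dV hdV dW hdW →
        unipDeltaChar L e dV hdV dW hdW (S : Matrix (Fin 2) (Fin 2) L)
            ((Λ (Matrix.GeneralLinearGroup.map (algebraMap L (AdeleRing (𝓞 L) L)) (γ (Projectivization.mk L (fw S) (hfw S h0 hd)))))⁻¹ * v *
              Λ (Matrix.GeneralLinearGroup.map (algebraMap L (AdeleRing (𝓞 L) L)) (γ (Projectivization.mk L (fw S) (hfw S h0 hd))))) =
          unipDeltaChar L e dV hdV dW hdW S' v := by
    intro S h0 hd
    obtain ⟨S', -, -, hS'⟩ := exists_levi_conj_index L e dV hdV dW hdW Λ hΛ hdV0 hdW0 (γ (Projectivization.mk L (fw S) (hfw S h0 hd))) (S : Matrix (Fin 2) (Fin 2) L)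
    exact ⟨S', hS'⟩
  choose! fS' hfS' using hidx
  -- THE FRAME: see-saw datum, Borel structures, additive Haar measure of `𝔸_{L⁺}`, line charts of `H(B)` and `H(A)` (opaque local constants)
  obtain ⟨eA⟩ : Nonempty (Fin 1 × Fin 1 ≃ Fin 1) := ⟨Equiv.prodUnique (Fin 1) (Fin 1)⟩
  obtain ⟨dA, hVA⟩ : ∃ dA : Fin 1 → L, ∀ i, dV (Fin.castAdd 1 i) = dA i := ⟨fun i => dV (Fin.castAdd 1 i), fun _ => rfl⟩
  obtain ⟨dB, hVB⟩ : ∃ dB : Fin 1 → L, ∀ j, dV (Fin.natAdd 1 j) = dB j := ⟨fun j => dV (Fin.natAdd 1 j), fun _ => rfl⟩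
  have hdA : ∀ i, IsCMField.complexConj L (dA i) = dA i := fun i => by rw [← hVA]; exact hdV _
  have hdB : ∀ i, IsCMField.complexConj L (dB i) = dB i := fun i => by rw [← hVB]; exact hdV _
  have hdA0 : ∀ i, dA i ≠ 0 := fun i => by rw [← hVA]; exact hdV0 _
  have hdB0 : ∀ i, dB i ≠ 0 := fun i => by rw [← hVB]; exact hdV0 _
  letI mB : MeasurableSpace (unipDelta L eA dB hdB dW hdW) := borel _
  haveI : BorelSpace (unipDelta L eA dB hdB dW hdW) := ⟨rfl⟩
  letI mA : MeasurableSpace (unipDelta L eA dA hdA dW hdW) := borel _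
  haveI : BorelSpace (unipDelta L eA dA hdA dW hdW) := ⟨rfl⟩
  letI mF : MeasurableSpace (AdeleRing (𝓞 (Fp L)) (Fp L)) := borel _
  haveI : BorelSpace (AdeleRing (𝓞 (Fp L)) (Fp L)) := ⟨rfl⟩
  haveI := secondCountableTopology_adeleRing (Fp L)
  haveI := locallyCompactSpace_adeleRing' (Fp L)
  have hLCB := exists_lineChart L eA dB hdB dW hdW
  obtain ⟨nB, hnBc, hnBadd, hnB⟩ := hLCB
  have hLCA := exists_lineChart L eA dA hdA dW hdW
  obtain ⟨nA, hnAc, hnAadd, hnA⟩ := hLCA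
  -- the `REST`-cell invariance ★ (ρ8)
  have hrestL := tsum_rest_unipDeltaRat_mul_family (fun s => hstd.1.1 s) wq hwq
  have hI0 : (0 : ℝ) ≤ ((∫⁻ u, β u ∂νN).toReal⁻¹ : ℝ) := inv_nonneg.2 ENNReal.toReal_nonneg
  by_cases he : e (1, 0) = 1
  · -- corner enumeration `e (1,0) = 1`: the line `B`
    obtain ⟨C₀, hC0, hCtop, hpinX⟩ := exists_pinConst_line L e dV hdV hdV0 dW hdW hdW0 lam hlam hw 𝒦 h𝒦 f hstd hcont νN β hβ hβ0 hβtop hK hβK wq hwq he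
      eA eA dA hdA dB hdB hdB0 hVA hVB Λ hΛ (Measure.addHaar : Measure (AdeleRing (𝓞 (Fp L)) (Fp L))) nB hnBc hnBadd hnB γ hγ
    have hC0' : (0 : ℝ) ≤ C₀.toReal := ENNReal.toReal_nonneg
    have hdecW := hWdec1 he eA eA dA hdA dB hdB hVA hVB Λ hΛ (Measure.addHaar : Measure (AdeleRing (𝓞 (Fp L)) (Fp L))) nB hnBc hnBadd hnB γ hγ
    -- the pinned term (an opaque local constant with its unfolding equation)
    have hTex : ∃ T : skewMatrices ((IsCMField.complexConj L : L ≃ₐ[Fp L] L) : L →+* L) ((gramR L e dV hdV dW hdW).map (algebraMap (Fp L) L)) → ℂ → HA L e dV hdV dW hdW → ℂ, ∀ S s h, T S s h =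
      if hS : (S : Matrix (Fin 2) (Fin 2) L) ≠ 0 ∧ (S : Matrix (Fin 2) (Fin 2) L).det = 0 then
        ((∫⁻ u, β u ∂νN).toReal⁻¹ : ℝ) •
          (C₀.toReal • whittakerDelta L eA dB hdB dW hdW (Measure.map nB (Measure.addHaar : Measure (AdeleRing (𝓞 (Fp L)) (Fp L))))
            ((Matrix.reindex (idxSplit e eA eA) (idxSplit e eA eA) (fS' S)).toBlocks₂₂)
            (fun y => f s (blkD L e eA eA dA hdA dB hdB dV hdV hVA hVB dW hdW (1, y) *
              (Λ (Matrix.GeneralLinearGroup.map (algebraMap L (AdeleRing (𝓞 L) L)) (γ (Projectivization.mk L (fw S) (hfw S hS.1 hS.2)))) * h))) 1)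
      else 0 := ⟨_, fun _ _ _ => rfl⟩
    obtain ⟨T, hT⟩ := hTex
    have key := fun (S : skewMatrices ((IsCMField.complexConj L : L ≃ₐ[Fp L] L) : L →+* L) ((gramR L e dV hdV dW hdW).map (algebraMap (Fp L) L)))
        (hS : (S : Matrix (Fin 2) (Fin 2) L) ≠ 0 ∧ (S : Matrix (Fin 2) (Fin 2) L).det = 0) =>
      hpinX S (hfS S hS.1 hS.2) (hfu S hS.1 hS.2) (hfw S hS.1 hS.2) (fS' S) (hfS' S hS.1 hS.2)
    refine exists_kindOne_lineTerm_of_pinnedTerm L e dV hdV hdV0 dW hdW hdW0 lam hlam hw 𝒦 h𝒦 f hstd hcont νN β hβ hβ0 hβtop hK hβK wq hwq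
      hrestL hlatU T (fun S h0 hd x => ?_) (fun S h0 hd s h hs => ?_) Nb (fun z hz => ?_)
    · have h1 := (key S ⟨h0, hd⟩).1 x
      simp only [hT, dif_pos (And.intro h0 hd)]
      exact h1
    · have h2 := (key S ⟨h0, hd⟩).2 s h hs
      simp only [hT, dif_pos (And.intro h0 hd)]
      exact h2
    · obtain ⟨C, a, a₂, c, a', r, hC, ha, ha₂, hc, ha', hr, hW⟩ := hdecW z hz
      refine ⟨((∫⁻ u, β u ∂νN).toReal⁻¹ : ℝ) * C₀.toReal * C, a, a₂, c, a', r, mul_nonneg (mul_nonneg hI0 hC0') hC, ha, ha₂, hc, ha', hr,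
        fun S h0 hd D hD hint s hs h => ?_⟩
      have hWle := hW S (fu S) (fw S) (hfS S h0 hd) (hfu S h0 hd) (hfw S h0 hd) (fS' S) (hfS' S h0 hd) D hD hint s hs h
      have hTeq : ‖T S s h‖ = ((∫⁻ u, β u ∂νN).toReal⁻¹ : ℝ) * (C₀.toReal *
          ‖whittakerDelta L eA dB hdB dW hdW (Measure.map nB (Measure.addHaar : Measure (AdeleRing (𝓞 (Fp L)) (Fp L))))
            ((Matrix.reindex (idxSplit e eA eA) (idxSplit e eA eA) (fS' S)).toBlocks₂₂)
            (fun y => f s (blkD L e eA eA dA hdA dB hdB dV hdV hVA hVB dW hdW (1, y) *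
              (Λ (Matrix.GeneralLinearGroup.map (algebraMap L (AdeleRing (𝓞 L) L)) (γ (Projectivization.mk L (fw S) (hfw S h0 hd)))) * h))) 1‖) := by
        simp only [hT, dif_pos (And.intro h0 hd), norm_smul, Real.norm_of_nonneg hI0, Real.norm_of_nonneg hC0']
      rw [hTeq]
      calc ((∫⁻ u, β u ∂νN).toReal⁻¹ : ℝ) * (C₀.toReal *
          ‖whittakerDelta L eA dB hdB dW hdW (Measure.map nB (Measure.addHaar : Measure (AdeleRing (𝓞 (Fp L)) (Fp L))))
            ((Matrix.reindex (idxSplit e eA eA) (idxSplit e eA eA) (fS' S)).toBlocks₂₂)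
            (fun y => f s (blkD L e eA eA dA hdA dB hdB dV hdV hVA hVB dW hdW (1, y) *
              (Λ (Matrix.GeneralLinearGroup.map (algebraMap L (AdeleRing (𝓞 L) L)) (γ (Projectivization.mk L (fw S) (hfw S h0 hd)))) * h))) 1‖)
          ≤ ((∫⁻ u, β u ∂νN).toReal⁻¹ : ℝ) * (C₀.toReal * (C * adelicHeightGL (2 + 2) L (h : GL (Fin (2 + 2)) (AdeleRing (𝓞 L) L)) ^ a * (D : ℝ) ^ a₂ *
              (Real.exp (-(c * adelicHeightGL (2 + 2) L (h : GL (Fin (2 + 2)) (AdeleRing (𝓞 L) L)) ^ (-a') * ‖(fun i j => NumberField.mixedEmbedding L ((S : Matrix (Fin 2) (Fin 2) L) i j))‖)) * (1 + ‖(fun i j => NumberField.mixedEmbedding L ((S : Matrix (Fin 2) (Fin 2) L) i j))‖) ^ Nb))) :=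
            mul_le_mul_of_nonneg_left (mul_le_mul_of_nonneg_left hWle hC0') hI0
        _ = ((∫⁻ u, β u ∂νN).toReal⁻¹ : ℝ) * C₀.toReal * C * adelicHeightGL (2 + 2) L (h : GL (Fin (2 + 2)) (AdeleRing (𝓞 L) L)) ^ a * (D : ℝ) ^ a₂ *
              (Real.exp (-(c * adelicHeightGL (2 + 2) L (h : GL (Fin (2 + 2)) (AdeleRing (𝓞 L) L)) ^ (-a') * ‖(fun i j => NumberField.mixedEmbedding L ((S : Matrix (Fin 2) (Fin 2) L) i j))‖)) * (1 + ‖(fun i j => NumberField.mixedEmbedding L ((S : Matrix (Fin 2) (Fin 2) L) i j))‖) ^ Nb) := by ring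
  · -- corner enumeration `e (1,0) = 0`: the line `A`
    have he0 : e (1, 0) = 0 := by
      have hlt : (e (1, 0)).val < 2 := (e (1, 0)).isLt
      have hne : (e (1, 0)).val ≠ 1 := fun h => he (Fin.ext h)
      exact Fin.ext (by simp only [Fin.val_zero]; omega)
    obtain ⟨C₀, hC0, hCtop, hpinX⟩ := exists_pinConst_line_inl L e dV hdV hdV0 dW hdW hdW0 lam hlam hw 𝒦 h𝒦 f hstd hcont νN β hβ hβ0 hβtop hK hβK wq hwq he0
      eA eA dA hdA hdA0 dB hdB hVA hVB Λ hΛ (Measure.addHaar : Measure (AdeleRing (𝓞 (Fp L)) (Fp L))) nA hnAc hnAadd hnA γ hγ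
    have hC0' : (0 : ℝ) ≤ C₀.toReal := ENNReal.toReal_nonneg
    have hdecW := hWdec0 he0 eA eA dA hdA dB hdB hVA hVB Λ hΛ (Measure.addHaar : Measure (AdeleRing (𝓞 (Fp L)) (Fp L))) nA hnAc hnAadd hnA γ hγ
    -- the pinned term (an opaque local constant with its unfolding equation)
    have hTex : ∃ T : skewMatrices ((IsCMField.complexConj L : L ≃ₐ[Fp L] L) : L →+* L) ((gramR L e dV hdV dW hdW).map (algebraMap (Fp L) L)) → ℂ → HA L e dV hdV dW hdW → ℂ, ∀ S s h, T S s h =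
      if hS : (S : Matrix (Fin 2) (Fin 2) L) ≠ 0 ∧ (S : Matrix (Fin 2) (Fin 2) L).det = 0 then
        ((∫⁻ u, β u ∂νN).toReal⁻¹ : ℝ) •
          (C₀.toReal • whittakerDelta L eA dA hdA dW hdW (Measure.map nA (Measure.addHaar : Measure (AdeleRing (𝓞 (Fp L)) (Fp L))))
            ((Matrix.reindex (idxSplit e eA eA) (idxSplit e eA eA) (fS' S)).toBlocks₁₁)
            (fun y => f s (blkD L e eA eA dA hdA dB hdB dV hdV hVA hVB dW hdW (y, 1) *
              (Λ (Matrix.GeneralLinearGroup.map (algebraMap L (AdeleRing (𝓞 L) L)) (γ (Projectivization.mk L (fw S) (hfw S hS.1 hS.2)))) * h))) 1)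
      else 0 := ⟨_, fun _ _ _ => rfl⟩
    obtain ⟨T, hT⟩ := hTex
    have key := fun (S : skewMatrices ((IsCMField.complexConj L : L ≃ₐ[Fp L] L) : L →+* L) ((gramR L e dV hdV dW hdW).map (algebraMap (Fp L) L)))
        (hS : (S : Matrix (Fin 2) (Fin 2) L) ≠ 0 ∧ (S : Matrix (Fin 2) (Fin 2) L).det = 0) =>
      hpinX S (hfS S hS.1 hS.2) (hfu S hS.1 hS.2) (hfw S hS.1 hS.2) (fS' S) (hfS' S hS.1 hS.2)
    refine exists_kindOne_lineTerm_of_pinnedTerm L e dV hdV hdV0 dW hdW hdW0 lam hlam hw 𝒦 h𝒦 f hstd hcont νN β hβ hβ0 hβtop hK hβK wq hwq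
      hrestL hlatU T (fun S h0 hd x => ?_) (fun S h0 hd s h hs => ?_) Nb (fun z hz => ?_)
    · have h1 := (key S ⟨h0, hd⟩).1 x
      simp only [hT, dif_pos (And.intro h0 hd)]
      exact h1
    · have h2 := (key S ⟨h0, hd⟩).2 s h hs
      simp only [hT, dif_pos (And.intro h0 hd)]
      exact h2
    · obtain ⟨C, a, a₂, c, a', r, hC, ha, ha₂, hc, ha', hr, hW⟩ := hdecW z hz
      refine ⟨((∫⁻ u, β u ∂νN).toReal⁻¹ : ℝ) * C₀.toReal * C, a, a₂, c, a', r, mul_nonneg (mul_nonneg hI0 hC0') hC, ha, ha₂, hc, ha', hr,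
        fun S h0 hd D hD hint s hs h => ?_⟩
      have hWle := hW S (fu S) (fw S) (hfS S h0 hd) (hfu S h0 hd) (hfw S h0 hd) (fS' S) (hfS' S h0 hd) D hD hint s hs h
      have hTeq : ‖T S s h‖ = ((∫⁻ u, β u ∂νN).toReal⁻¹ : ℝ) * (C₀.toReal *
          ‖whittakerDelta L eA dA hdA dW hdW (Measure.map nA (Measure.addHaar : Measure (AdeleRing (𝓞 (Fp L)) (Fp L))))
            ((Matrix.reindex (idxSplit e eA eA) (idxSplit e eA eA) (fS' S)).toBlocks₁₁)
            (fun y => f s (blkD L e eA eA dA hdA dB hdB dV hdV hVA hVB dW hdW (y, 1) *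
              (Λ (Matrix.GeneralLinearGroup.map (algebraMap L (AdeleRing (𝓞 L) L)) (γ (Projectivization.mk L (fw S) (hfw S h0 hd)))) * h))) 1‖) := by
        simp only [hT, dif_pos (And.intro h0 hd), norm_smul, Real.norm_of_nonneg hI0, Real.norm_of_nonneg hC0']
      rw [hTeq]
      calc ((∫⁻ u, β u ∂νN).toReal⁻¹ : ℝ) * (C₀.toReal *
          ‖whittakerDelta L eA dA hdA dW hdW (Measure.map nA (Measure.addHaar : Measure (AdeleRing (𝓞 (Fp L)) (Fp L))))
            ((Matrix.reindex (idxSplit e eA eA) (idxSplit e eA eA) (fS' S)).toBlocks₁₁)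
            (fun y => f s (blkD L e eA eA dA hdA dB hdB dV hdV hVA hVB dW hdW (y, 1) *
              (Λ (Matrix.GeneralLinearGroup.map (algebraMap L (AdeleRing (𝓞 L) L)) (γ (Projectivization.mk L (fw S) (hfw S h0 hd)))) * h))) 1‖)
          ≤ ((∫⁻ u, β u ∂νN).toReal⁻¹ : ℝ) * (C₀.toReal * (C * adelicHeightGL (2 + 2) L (h : GL (Fin (2 + 2)) (AdeleRing (𝓞 L) L)) ^ a * (D : ℝ) ^ a₂ *
              (Real.exp (-(c * adelicHeightGL (2 + 2) L (h : GL (Fin (2 + 2)) (AdeleRing (𝓞 L) L)) ^ (-a') * ‖(fun i j => NumberField.mixedEmbedding L ((S : Matrix (Fin 2) (Fin 2) L) i j))‖)) * (1 + ‖(fun i j => NumberField.mixedEmbedding L ((S : Matrix (Fin 2) (Fin 2) L) i j))‖) ^ Nb))) :=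
            mul_le_mul_of_nonneg_left (mul_le_mul_of_nonneg_left hWle hC0') hI0
        _ = ((∫⁻ u, β u ∂νN).toReal⁻¹ : ℝ) * C₀.toReal * C * adelicHeightGL (2 + 2) L (h : GL (Fin (2 + 2)) (AdeleRing (𝓞 L) L)) ^ a * (D : ℝ) ^ a₂ *
              (Real.exp (-(c * adelicHeightGL (2 + 2) L (h : GL (Fin (2 + 2)) (AdeleRing (𝓞 L) L)) ^ (-a') * ‖(fun i j => NumberField.mixedEmbedding L ((S : Matrix (Fin 2) (Fin 2) L) i j))‖)) * (1 + ‖(fun i j => NumberField.mixedEmbedding L ((S : Matrix (Fin 2) (Fin 2) L) i j))‖) ^ Nb) := by ring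

end Summit.HodgeConjecture.HodgeConjecture.Cruxes.HLiu418.K2LiuKindOneLineTermOfRecord

end
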